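import Literature.AnabelianGeometry.SemiGraphs.UniversalCoveringOverRigid
import Literature.AnabelianGeometry.SemiGraphs.UniversalCoveringOverDeck
import Literature.AnabelianGeometry.SemiGraphs.FundamentalGroupFreeProofs
import Literature.GroupTheory.CombinatorialGroupTheory.VirtuallyFreeResiduallyFinite
import HarnessLib

/-!
# `Aut(𝒢_{∞,F})` is free-by-finite, hence residually finite ([SemiAnbd] §3 pp. 38–39)

Mochizuki, *Semi-graphs of anabelioids*, §3 p. 38: for a connected finite étale Galois covering
`𝒢_i → 𝒢`, the covering `𝒢_{∞,i} → 𝒢` ("determined by the universal graph-covering of `𝔾_i`") is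
Galois with `Gal(𝒢_{∞,i}/𝒢_i) ≅ π₁(𝔾_i)` (a free group) of finite index in `Gal(𝒢_{∞,i}/𝒢)`; p. 39
(proof of Prop. 3.6 (iii)): "`Gal(H'_i/G)` is residually finite … an extension of a finite group
by a free group".

For `F` an object of `B^cov(𝒢)` with base point `x₀ ∈ F_{v₀}` such that the endomorphisms of `F`
act transitively on `F_{v₀}` (`htrans`) and are determined by their value at `x₀` (`hrigid` — both
hold for a connected finite étale Galois covering), every automorphism `α` of `𝒢_{∞,F} = F.univCoverOver [x₀]`
(`UniversalCoveringOver.lean`) *descends* uniquely to `F` (`CovObj.autDescend`, by the rigidity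
`univCoverOver_hom_ext` of `UniversalCoveringOverRigid.lean`); the kernel of the descent
homomorphism is exactly the deck group `π₁(𝔾_F, [x₀])` (`UniversalCoveringOverDeck.lean`), which
is free (`FundamentalGroupFreeProofs.lean`), and its image is finite; so `Aut(𝒢_{∞,F})` is
residually finite (`VirtuallyFreeResiduallyFinite.lean`).  This is input (g2) of the reduction
`temperedPiResiduallyFinite_of_(pointed)GaloisDomination` of Prop. 3.6 (iii).
-/

namespace Literature.AnabelianGeometry.SemiGraphs

namespace ProfiniteSemiGraph

open CategoryTheory
open Literature.GroupTheory.CombinatorialGroupTheory (residuallyFinite_of_free_by_finite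
  residuallyFinite_congr)

universe u

variable {𝒢 : ProfiniteSemiGraph.{u}} (F : CovObj 𝒢) (v₀ : 𝒢.graph.Vertex) (x₀ : (F.SV v₀).obj.V)
  (h𝒢 : 𝒢.IsCountable)

/-- The base component of `𝔾_F`: the orbit of `x₀`. [cite: MochizukiSemiAnbd2006, Prop 3.6 p.38] -/
abbrev CovObj.baseComp : F.orbitGraph.CatCarrier := Sum.inl (Quot.mk F.VRel ⟨v₀, x₀⟩)

/-- The base point `([x₀], x₀, 𝟙)` of `𝒢_{∞,F}` over `v₀`. [cite: MochizukiSemiAnbd2006, Prop 3.6 p.38] -/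
noncomputable def CovObj.autBasePt : F.FibV (F.baseComp v₀ x₀) v₀ :=
  ⟨⟨Quot.mk F.VRel ⟨v₀, x₀⟩, rfl⟩, ⟨⟨x₀, rfl⟩, 𝟙 _⟩⟩

/-- Components of composites of `B^cov(𝒢)`-morphisms, pointwise.
[cite: MochizukiSemiAnbd2006, §3 p.36] -/
theorem CovHom.comp_fV_apply {S T U : CovObj 𝒢} (f : S ⟶ T) (g : T ⟶ U) (v : 𝒢.graph.Vertex)
    (x : (S.SV v).obj.V) : ((f ≫ g).fV v).hom.hom x = (g.fV v).hom.hom ((f.fV v).hom.hom x) := rfl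

section Descent

variable (htrans : ∀ x : (F.SV v₀).obj.V, ∃ σ : F ⟶ F, (σ.fV v₀).hom.hom x₀ = x)
  (hrigid : ∀ σ σ' : F ⟶ F, (σ.fV v₀).hom.hom x₀ = (σ'.fV v₀).hom.hom x₀ → σ = σ')

include hrigid in
/-- If endomorphisms of `F` are determined by their value at `x₀` and `F_{v₀}` is finite, `Aut F`
is finite. [cite: MochizukiSemiAnbd2006, Def 3.5(iii) p.37] -/
theorem CovObj.finite_aut_of_rigid [Finite ((F.SV v₀).obj.V)] : Finite (Aut F) :=
  Finite.of_injective (fun σ : Aut F => (σ.hom.fV v₀).hom.hom x₀)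
    fun _ _ h => Aut.ext (hrigid _ _ h)

include htrans hrigid in
/-- **Descent.** Every automorphism `α` of `𝒢_{∞,F}` lies over a unique endomorphism `σ` of `F`:
`α ≫ pr = pr ≫ σ`.  Existence: `σ` is the endomorphism moving `x₀` to the image of
`α([x₀], x₀, 𝟙)` (transitivity), and the two sides agree at the base point, hence everywhere
(rigidity of `𝒢_{∞,F}`); uniqueness: rigidity of `F` at `x₀`. [cite: MochizukiSemiAnbd2006, Prop 3.6 p.38] -/
theorem CovObj.existsUnique_descend (α : Aut (F.univCoverOver (F.baseComp v₀ x₀) h𝒢)) :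
    ∃! σ : F ⟶ F, α.hom ≫ F.univCoverOverProj _ h𝒢 = F.univCoverOverProj _ h𝒢 ≫ σ := by
  obtain ⟨σ, hσ⟩ := htrans (((α.hom ≫ F.univCoverOverProj _ h𝒢).fV v₀).hom.hom
    (F.autBasePt v₀ x₀))
  refine ⟨σ, ?_, fun σ' hσ' => ?_⟩
  · refine F.univCoverOver_hom_ext _ h𝒢 _ _ (F.autBasePt v₀ x₀) ?_
    rw [CovHom.comp_fV_apply (F.univCoverOverProj _ h𝒢) σ]
    exact hσ.symm
  · apply hrigid
    have h' := congrArg (fun φ : F.univCoverOver (F.baseComp v₀ x₀) h𝒢 ⟶ F =>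
      (φ.fV v₀).hom.hom (F.autBasePt v₀ x₀)) hσ'
    change _ = (σ'.fV v₀).hom.hom x₀ at h'
    rw [← h', hσ]

/-- The endomorphism of `F` under an automorphism of `𝒢_{∞,F}`.
[cite: MochizukiSemiAnbd2006, Prop 3.6 p.38] -/
noncomputable def CovObj.descendEnd (α : Aut (F.univCoverOver (F.baseComp v₀ x₀) h𝒢)) : F ⟶ F :=
  (CovObj.existsUnique_descend F v₀ x₀ h𝒢 htrans hrigid α).choose

/-- The descended endomorphism lies under `α`. [cite: MochizukiSemiAnbd2006, Prop 3.6 p.38] -/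
theorem CovObj.descendEnd_spec (α : Aut (F.univCoverOver (F.baseComp v₀ x₀) h𝒢)) :
    α.hom ≫ F.univCoverOverProj _ h𝒢 =
      F.univCoverOverProj _ h𝒢 ≫ CovObj.descendEnd F v₀ x₀ h𝒢 htrans hrigid α :=
  (CovObj.existsUnique_descend F v₀ x₀ h𝒢 htrans hrigid α).choose_spec.1

/-- Uniqueness of the descent. [cite: MochizukiSemiAnbd2006, Prop 3.6 p.38] -/
theorem CovObj.descendEnd_unique (α : Aut (F.univCoverOver (F.baseComp v₀ x₀) h𝒢)) (σ : F ⟶ F)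
    (hσ : α.hom ≫ F.univCoverOverProj _ h𝒢 = F.univCoverOverProj _ h𝒢 ≫ σ) :
    σ = CovObj.descendEnd F v₀ x₀ h𝒢 htrans hrigid α :=
  (CovObj.existsUnique_descend F v₀ x₀ h𝒢 htrans hrigid α).choose_spec.2 σ hσ

/-- Descent of the identity. [cite: MochizukiSemiAnbd2006, Prop 3.6 p.38] -/
theorem CovObj.descendEnd_one : CovObj.descendEnd F v₀ x₀ h𝒢 htrans hrigid 1 = 𝟙 F :=
  (CovObj.descendEnd_unique F v₀ x₀ h𝒢 htrans hrigid 1 (𝟙 F) (by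
    change 𝟙 _ ≫ _ = _ ≫ 𝟙 _
    rw [Category.id_comp, Category.comp_id])).symm

/-- Descent of a product: `σ_{αβ} = σ_β ≫ σ_α`. [cite: MochizukiSemiAnbd2006, Prop 3.6 p.38] -/
theorem CovObj.descendEnd_mul (α β : Aut (F.univCoverOver (F.baseComp v₀ x₀) h𝒢)) :
    CovObj.descendEnd F v₀ x₀ h𝒢 htrans hrigid (α * β) =
      CovObj.descendEnd F v₀ x₀ h𝒢 htrans hrigid β ≫ CovObj.descendEnd F v₀ x₀ h𝒢 htrans hrigid α :=
  (CovObj.descendEnd_unique F v₀ x₀ h𝒢 htrans hrigid (α * β) _ (by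
    change (β.hom ≫ α.hom) ≫ _ = _
    rw [Category.assoc, CovObj.descendEnd_spec F v₀ x₀ h𝒢 htrans hrigid α, ← Category.assoc,
      CovObj.descendEnd_spec F v₀ x₀ h𝒢 htrans hrigid β, Category.assoc])).symm

/-- The descent of an automorphism of `𝒢_{∞,F}` is an automorphism of `F` (its inverse is the
descent of the inverse). [cite: MochizukiSemiAnbd2006, Prop 3.6 p.38] -/
noncomputable def CovObj.autDescend (α : Aut (F.univCoverOver (F.baseComp v₀ x₀) h𝒢)) : Aut F where
  hom := CovObj.descendEnd F v₀ x₀ h𝒢 htrans hrigid α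
  inv := CovObj.descendEnd F v₀ x₀ h𝒢 htrans hrigid α⁻¹
  hom_inv_id := by
    rw [← CovObj.descendEnd_mul, inv_mul_cancel, CovObj.descendEnd_one]
  inv_hom_id := by
    rw [← CovObj.descendEnd_mul, mul_inv_cancel, CovObj.descendEnd_one]

/-- **The descent homomorphism** `Aut(𝒢_{∞,F}) →* Aut(F)` ("`Gal(𝒢_{∞,i}/𝒢) → Gal(𝒢_i/𝒢)`").
[cite: MochizukiSemiAnbd2006, Prop 3.6 p.38] -/
noncomputable def CovObj.autDescendHom : Aut (F.univCoverOver (F.baseComp v₀ x₀) h𝒢) →* Aut F where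
  toFun := CovObj.autDescend F v₀ x₀ h𝒢 htrans hrigid
  map_one' := Aut.ext (CovObj.descendEnd_one F v₀ x₀ h𝒢 htrans hrigid)
  map_mul' α β := Aut.ext (CovObj.descendEnd_mul F v₀ x₀ h𝒢 htrans hrigid α β)

/-- The kernel of the descent homomorphism: the automorphisms over `F`.
[cite: MochizukiSemiAnbd2006, Prop 3.6 p.38] -/
theorem CovObj.autDescendHom_eq_one_iff (α : Aut (F.univCoverOver (F.baseComp v₀ x₀) h𝒢)) :
    CovObj.autDescendHom F v₀ x₀ h𝒢 htrans hrigid α = 1 ↔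
      α.hom ≫ F.univCoverOverProj _ h𝒢 = F.univCoverOverProj _ h𝒢 := by
  constructor
  · intro h
    have h1 : CovObj.descendEnd F v₀ x₀ h𝒢 htrans hrigid α = 𝟙 F := congrArg Iso.hom h
    have := CovObj.descendEnd_spec F v₀ x₀ h𝒢 htrans hrigid α
    rw [h1] at this
    exact this.trans (Category.comp_id _)
  · intro h
    exact Aut.ext (CovObj.descendEnd_unique F v₀ x₀ h𝒢 htrans hrigid α (𝟙 F)
      (h.trans (Category.comp_id _).symm)).symm

end Descent

section Deck

/-- **The deck homomorphism** `π₁(𝔾_F, [x₀]) →* Aut(𝒢_{∞,F})`, `γ ↦ (deck transformation of γ⁻¹)`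
(the inverse makes it a homomorphism for Mathlib's composition order on `Aut`).
[cite: MochizukiSemiAnbd2006, Prop 3.6 p.38] -/
noncomputable def CovObj.deckHom :
    F.orbitGraph.FundamentalGroup (F.baseComp v₀ x₀) →*
      Aut (F.univCoverOver (F.baseComp v₀ x₀) h𝒢) where
  toFun γ := F.deckOverAut _ h𝒢 γ⁻¹
  map_one' := Aut.ext (by
    change F.deckOver _ h𝒢 1⁻¹ = 𝟙 _
    rw [inv_one, CovObj.deckOver_one])
  map_mul' γ δ := Aut.ext (by
    change F.deckOver _ h𝒢 (γ * δ)⁻¹ = F.deckOver _ h𝒢 δ⁻¹ ≫ F.deckOver _ h𝒢 γ⁻¹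
    rw [mul_inv_rev, CovObj.deckOver_mul])

/-- The deck homomorphism on the base point: `deckHom γ ([x₀], x₀, 𝟙) = ([x₀], x₀, γ)`.
[cite: MochizukiSemiAnbd2006, Prop 3.6 p.38] -/
theorem CovObj.deckHom_apply_autBasePt (γ : F.orbitGraph.FundamentalGroup (F.baseComp v₀ x₀)) :
    (((CovObj.deckHom F v₀ x₀ h𝒢 γ).hom.fV v₀).hom.hom (F.autBasePt v₀ x₀)) =
      ⟨⟨Quot.mk F.VRel ⟨v₀, x₀⟩, rfl⟩, ⟨⟨x₀, rfl⟩, γ⟩⟩ := by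
  refine CovObj.FibV.ext F _ rfl rfl (heq_of_eq ?_)
  change inv γ⁻¹ ≫ 𝟙 _ = γ
  rw [Category.comp_id, Groupoid.vertexGroup.inv_eq_inv, IsIso.inv_inv]

/-- The deck homomorphism is injective (the deck action is free).
[cite: MochizukiSemiAnbd2006, Prop 3.6 p.38] -/
theorem CovObj.deckHom_injective : Function.Injective (CovObj.deckHom F v₀ x₀ h𝒢) := by
  intro γ δ h
  have hγ := CovObj.deckHom_apply_autBasePt F v₀ x₀ h𝒢 γ
  rw [h, CovObj.deckHom_apply_autBasePt] at hγ
  have := (Sigma.mk.inj_iff.mp hγ).2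
  exact ((Prod.mk.inj (eq_of_heq this)).2).symm

end Deck

section Exact

variable (htrans : ∀ x : (F.SV v₀).obj.V, ∃ σ : F ⟶ F, (σ.fV v₀).hom.hom x₀ = x)
  (hrigid : ∀ σ σ' : F ⟶ F, (σ.fV v₀).hom.hom x₀ = (σ'.fV v₀).hom.hom x₀ → σ = σ')

/-- **Exactness:** the kernel of the descent homomorphism is the deck group.  `⊆`: an automorphism
over `F` moves the base point `([x₀], x₀, 𝟙)` to some `([x₀], x₀, γ)`, hence equals the deck
transformation of `γ` by rigidity; `⊇`: deck transformations lie over `F`.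
[cite: MochizukiSemiAnbd2006, Prop 3.6 p.38] -/
theorem CovObj.range_deckHom_eq_ker :
    (CovObj.deckHom F v₀ x₀ h𝒢).range = (CovObj.autDescendHom F v₀ x₀ h𝒢 htrans hrigid).ker := by
  ext α
  rw [MonoidHom.mem_ker, CovObj.autDescendHom_eq_one_iff, MonoidHom.mem_range]
  constructor
  · rintro ⟨γ, rfl⟩
    exact F.deckOver_comp_proj _ h𝒢 γ⁻¹
  · intro hover
    -- the image `t` of the base point lies over `x₀`, hence in the base orbit: `t = ([x₀], x₀, γ)`
    have hx : ((α.hom.fV v₀).hom.hom (F.autBasePt v₀ x₀)).2.1.1 = x₀ :=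
      congrArg (fun φ : F.univCoverOver (F.baseComp v₀ x₀) h𝒢 ⟶ F =>
        (φ.fV v₀).hom.hom (F.autBasePt v₀ x₀)) hover
    have hV : ((α.hom.fV v₀).hom.hom (F.autBasePt v₀ x₀)).1.1 = Quot.mk F.VRel ⟨v₀, x₀⟩ := by
      rw [← ((α.hom.fV v₀).hom.hom (F.autBasePt v₀ x₀)).2.1.2, hx]
    refine ⟨((α.hom.fV v₀).hom.hom (F.autBasePt v₀ x₀)).2.2 ≫ eqToHom (by rw [hV]),
      Aut.ext (F.univCoverOver_hom_ext _ h𝒢 _ _ (F.autBasePt v₀ x₀) ?_)⟩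
    rw [CovObj.deckHom_apply_autBasePt]
    exact CovObj.FibV.ext F _ (Subtype.ext hV.symm) hx.symm (comp_eqToHom_heq _ _)

include htrans hrigid in
/-- **`Aut(𝒢_{∞,F})` is residually finite** when the endomorphisms of `F` act transitively on the
finite fibre `F_{v₀}` and are determined by their value at `x₀` (e.g. `F` a connected finite étale
Galois covering): it is an extension of a subgroup of the finite group `Aut F` by the free group
`π₁(𝔾_F, [x₀])` ([SemiAnbd] p. 39, "`Gal(H'_i/G)` is residually finite").
[cite: MochizukiSemiAnbd2006, Prop 3.6(iii) p.39] -/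
theorem CovObj.residuallyFinite_aut_univCoverOver [Finite ((F.SV v₀).obj.V)] :
    Group.ResiduallyFinite (Aut (F.univCoverOver (F.baseComp v₀ x₀) h𝒢)) := by
  haveI := SemiGraph.isFreeGroup_fundamentalGroup F.orbitGraph (F.baseComp v₀ x₀)
  haveI : Finite (Aut F) := CovObj.finite_aut_of_rigid F v₀ x₀ hrigid
  exact residuallyFinite_of_free_by_finite (CovObj.deckHom F v₀ x₀ h𝒢)
    (CovObj.autDescendHom F v₀ x₀ h𝒢 htrans hrigid) (CovObj.deckHom_injective F v₀ x₀ h𝒢)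
    (CovObj.range_deckHom_eq_ker F v₀ x₀ h𝒢 htrans hrigid)

include htrans hrigid in
/-- The same for `𝒢_{∞,F}` regarded as an object of the full subcategory `B^temp(𝒢)` (when it is
tempered, e.g. `univCoverOver_isTempered`): automorphism groups in a full subcategory agree.
[cite: MochizukiSemiAnbd2006, Prop 3.6(iii) p.39] -/
theorem CovObj.residuallyFinite_aut_univCoverOver_btemp [Finite ((F.SV v₀).obj.V)]
    (hT : (F.univCoverOver (F.baseComp v₀ x₀) h𝒢).IsTempered) :
    Group.ResiduallyFinite (Aut (⟨F.univCoverOver (F.baseComp v₀ x₀) h𝒢, hT⟩ : BTempCat 𝒢)) :=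
  (residuallyFinite_congr ((ObjectProperty.fullyFaithfulι _).autMulEquivOfFullyFaithful
    (⟨F.univCoverOver (F.baseComp v₀ x₀) h𝒢, hT⟩ : BTempCat 𝒢))).mpr
    (CovObj.residuallyFinite_aut_univCoverOver F v₀ x₀ h𝒢 htrans hrigid)

end Exact

end ProfiniteSemiGraph

end Literature.AnabelianGeometry.SemiGraphs
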